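import Mathlib

/-!
# `BalabanImbrieJaffe1984to88.BIJ85LandauForm441` — T. Bałaban, J. Imbrie, A. Jaffe, *Renormalization of the Higgs model:
minimizers, propagators and the stability of mean field theory*, Commun. Math. Phys. **97** (1985) 299–329
[BalabanImbrieJaffe1985]: Sect. 4.4 pp. 311–313 — the linear operators behind the Landau-gauge Faddeev–Popov function (4.4.1)
and the minimizer (4.4.2), the quadratic form `½‖∂A‖² + ½‖R∂*A‖²` they produce, its constrained critical points, and the Landau
gauge condition `R∂*A = 0` of [Balaban1984PropagatorsI] p. 25 (file 1/2; file 2/2 = `BIJ85LandauMinimizer442`, the Gaussian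
integrals (4.4.1)–(4.4.3) themselves)

statement-level skeleton of published theorems with citation tags; proofs where landed; nothing here is a claim about the Yang–Mills mass gap

PDF held: `paper:balaban1985-cmp97-bij-higgs-minimizers` (journal page = PDF page + 298); renders of pp. 311–312 [PDF 13–14]
(`run/shared/lean/pub/lit-balaban/lit-balaban-r15/pages/…-p013-x2.png`, `…-p014-x2.png`) read as images; [6I] =
[Balaban1984PropagatorsI] = `paper:balaban1984-cmp95-propagators-rt-i`, p. 25 [PDF 9] (text layer).

CITATION HEADER (lean-in-tree rule).  Phase-2 proof seat p11 of the mega-formalization `lit-balaban` (HOME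
`run/shared/lean/pub/lit-balaban/`), SPARE row **C1.Eq4.4.1-4.4.3** of `PHASE2-TARGETS.md` §G.6 (footer list).  THE PRINTED TEXT,
verbatim.  p. 311: *"Landau gauge is defined for our lattice theory in a complicated way, because of the restrictions on gauge
transformations. We introduce a gauge fixing function 𝒢(∂*A). The exact form of 𝒢 is important for the proof of estimates. An
appropriate choice is 𝒢(∂*A) = exp(−½‖∂*A‖²)/(∫dλ δ(Q′λ) exp(−½‖∂*A − Δλ‖²)), (4.4.1)"*; p. 312: *"where Q′ denotes the
ordinary average over k-blocks. Such a Faddeev-Popov type choice leads to the formula for the Landau gauge minimizer H_kB =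
Z_k(B)⁻¹∫𝒟A δ(Q_kA − B)𝒢(∂*A) A exp(−½‖∂A‖²), (4.4.2) where Z_k(B) = ∫𝒟A δ(Q_kA − B)𝒢(∂*A) exp(−½‖∂A‖²). (4.4.3)"*; p. 313:
*"Recall that H_kB is the configuration which minimizes the action ½‖∂A‖², subject to a gauge condition as well as the
restriction Q_kA = B on field averages."*  [6I] p. 25: *"The projection operator R has a clear meaning. It is an orthogonal
projection on the linear subspace ΔN(Q′_k) of L²(T_η), N(Q′_k) = {λ : Q′_kλ = 0}. … Let us denote this subspace by R also, R =
ΔN(Q′_k). … the operator Δ is positive definite on N(Q′_k), thus invertible, as it follows from [2]"*; p. 26: the Landau gauge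
condition *"under the conditions Q_kA = B, R∂*A = 0"*.

WHAT IS TYPED HERE (carrier `LandauOps`: the five LINEAR lattice operators ∂ (curl), ∂* (divergence), Δ, Q_k, Q′ of Sect. 4
between arbitrary finite-dimensional real inner-product spaces — η-lattice bond fields `EA` with ‖A‖² = Σ_b η^d|A(b)|², site
functions `ES`, plaquette fields `EP`, unit-lattice bond fields `EB` and site functions `ES′`; the paper's U(1) Lie algebra is
`ℝ`): the subspaces `N(Q′)`, `R = ΔN(Q′)` with its orthogonal projection `R` ([6I] p. 25), the fibres `{Q_kA = B}` of the
constraint δ(Q_kA − B), the quadratic form `E(A) = ½‖∂A‖² + ½‖R∂*A‖²` (= the exponent of 𝒢(∂*A)e^{−½‖∂A‖²} after the λ-integration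
of (4.4.1): theorem `BIJ85LandauMinimizer442.LandauOps.weight_eq`), with the two printed non-degeneracy inputs kept as
DISPLAYED HYPOTHESES of the theorems that need them (no zero modes — the Landau-gauge form of the claim of p. 309 — and «Δ is positive
definite on N(Q′_k)», [6I] p. 25).  PROVED: existence of the constrained minimizer of `E` (`exists_isMinOn`), the first-order condition at a constrained
minimizer of `E` (`energy_split_of_isMinOn`), and — given the abelian gauge structure ∂∂λ = 0, ∂*∂λ = Δλ, Q_k∂λ = 0 (λ ∈ N(Q′))
([6I] (1.13)/(1.20)) — that such a minimizer satisfies the LANDAU GAUGE CONDITION `R∂*A = 0` and minimizes `½‖∂A‖²` on `{Q_kA = B,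
R∂*A = 0}` (`projR_dstar_eq_zero_of_isMinOn`, `isMinOn_curl_of_isMinOn`).  Carrier clauses (F6): the identification of the five
operators with the printed lattice ones (any concrete model, e.g. the V1 calculus `Balaban1983to89.LatticeFieldCalculus` or the
[6I] torus model `Balaban1983to89.B5Hk163Torus`) is the instance's.  Axioms: the standard three.  Unit `lit-balaban-p11`
(literature-prover-lit-balaban-p11-0).
-/

namespace Literature.MathematicalPhysics.QuantumFieldTheory.BalabanImbrieJaffe1984to88.BIJ85LandauForm441

open scoped InnerProductSpace

noncomputable section

/-- first-order condition of a one-variable quadratic: `0 ≤ tc + t²e` for all real `t` (with `e ≥ 0`) forces `c = 0`.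
[folklore] -/
private theorem eq_zero_of_quad_nonneg {c e : ℝ} (he : 0 ≤ e) (h : ∀ t : ℝ, 0 ≤ t * c + t ^ 2 * e) : c = 0 := by
  have he1 : 0 < e + 1 := by linarith
  have h1 := h (-c / (e + 1))
  have hid : -c / (e + 1) * c + (-c / (e + 1)) ^ 2 * e = -((c / (e + 1)) ^ 2) := by
    field_simp
    ring
  rw [hid] at h1
  have hsq : (c / (e + 1)) ^ 2 = 0 := le_antisymm (by linarith) (sq_nonneg _)
  have := pow_eq_zero_iff (n := 2) (by norm_num) |>.mp hsq
  rcases div_eq_zero_iff.mp this with h | h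
  · exact h
  · exact absurd h he1.ne'

/-- `‖y‖² ≤ 2‖x + y‖² + 2‖x‖²`. [folklore] -/
private theorem norm_sq_le_two_mul {X : Type*} [SeminormedAddCommGroup X] (x y : X) :
    ‖y‖ ^ 2 ≤ 2 * ‖x + y‖ ^ 2 + 2 * ‖x‖ ^ 2 := by
  have h : ‖y‖ ≤ ‖x + y‖ + ‖x‖ := by
    calc ‖y‖ = ‖(x + y) - x‖ := by rw [add_sub_cancel_left]
      _ ≤ ‖x + y‖ + ‖x‖ := norm_sub_le _ _
  nlinarith [norm_nonneg y, norm_nonneg (x + y), norm_nonneg x, sq_nonneg (‖x + y‖ - ‖x‖)]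

/-- an injective linear map on a finite-dimensional space is bounded below. [folklore] -/
private theorem exists_mul_norm_sq_le {V F : Type*} [NormedAddCommGroup V] [NormedSpace ℝ V] [FiniteDimensional ℝ V]
    [NormedAddCommGroup F] [NormedSpace ℝ F] (T : V →ₗ[ℝ] F) (hT : LinearMap.ker T = ⊥) :
    ∃ m : ℝ, 0 < m ∧ ∀ v, m * ‖v‖ ^ 2 ≤ ‖T v‖ ^ 2 := by
  obtain ⟨K, hK, hA⟩ := T.exists_antilipschitzWith hT
  refine ⟨((K : ℝ) ^ 2)⁻¹, by positivity, fun v => ?_⟩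
  have h := hA.le_mul_dist v 0
  simp only [dist_zero_right, map_zero] at h
  have hK' : (0 : ℝ) < K := by exact_mod_cast hK
  rw [inv_mul_le_iff₀ (by positivity)]
  calc ‖v‖ ^ 2 ≤ ((K : ℝ) * ‖T v‖) ^ 2 := by gcongr
    _ = (K : ℝ) ^ 2 * ‖T v‖ ^ 2 := by ring

variable {EA ES EP EB ES' : Type*}
  [NormedAddCommGroup EA] [InnerProductSpace ℝ EA]
  [NormedAddCommGroup ES] [InnerProductSpace ℝ ES]
  [NormedAddCommGroup EP] [InnerProductSpace ℝ EP]
  [AddCommGroup EB] [Module ℝ EB] [AddCommGroup ES'] [Module ℝ ES']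

variable (EA ES EP EB ES') in
/-- Carrier of Sect. 4.4: the five linear lattice operators of the displays (4.4.1)–(4.4.3) — `curl` = ∂ on η-lattice bond
fields (‖∂A‖²), `dstar` = ∂* (bond fields → site functions), `lap` = Δ (site functions), `Qk` = Q_k (the k-fold bond average,
η-lattice → unit lattice), `Qp` = Q′ (*"the ordinary average over k-blocks"* of site functions) — between finite-dimensional
real inner-product spaces (‖·‖² = the printed η-lattice norms Σ η^d|·|²).  Carrier clauses (F6): which concrete operators these
are is the instance's. [cite: BalabanImbrieJaffe1985, (4.4.1)–(4.4.3) p.311–312] -/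
structure LandauOps where
  /-- `∂` : the curl (plaquette field) of an η-lattice bond field -/
  curl : EA →ₗ[ℝ] EP
  /-- `∂*` : the divergence (site function) of an η-lattice bond field -/
  dstar : EA →ₗ[ℝ] ES
  /-- `Δ` : the η-lattice Laplacian on site functions -/
  lap : ES →ₗ[ℝ] ES
  /-- `Q_k` : the k-fold bond average -/
  Qk : EA →ₗ[ℝ] EB
  /-- `Q′` : the ordinary k-block average of site functions -/
  Qp : ES →ₗ[ℝ] ES'

namespace LandauOps

variable (D : LandauOps EA ES EP EB ES')

/-- `N(Q′) = {λ : Q′λ = 0}` ([6I] p. 25), the domain of the λ-integral `∫dλ δ(Q′λ)(…)` of (4.4.1).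
[cite: BalabanImbrieJaffe1985, (4.4.1) p.311] -/
def kerQp : Submodule ℝ ES := LinearMap.ker D.Qp

/-- membership in `N(Q′)`. [cite: BalabanImbrieJaffe1985, (4.4.1) p.311] -/
theorem mem_kerQp {l : ES} : l ∈ D.kerQp ↔ D.Qp l = 0 := LinearMap.mem_ker

/-- the subspace `R = ΔN(Q′)` of [6I] p. 25 (*"Let us denote this subspace by R also, R = ΔN(Q′_k)"*).
[cite: Balaban1984PropagatorsI, p.25 (text)] -/
def gaugeRange : Submodule ℝ ES := D.kerQp.map D.lap

/-- `N(Q_k) = {A : Q_kA = 0}`, the direction space of the fibres `{A : Q_kA = B}` of the constraint `δ(Q_kA − B)` in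
(4.4.2)–(4.4.3). [cite: BalabanImbrieJaffe1985, (4.4.3) p.312] -/
def kerQk : Submodule ℝ EA := LinearMap.ker D.Qk

/-- membership in `N(Q_k)`. [cite: BalabanImbrieJaffe1985, (4.4.3) p.312] -/
theorem mem_kerQk {A : EA} : A ∈ D.kerQk ↔ D.Qk A = 0 := LinearMap.mem_ker

/-- the fibre `{A : Q_kA = B}` of the constraint `δ(Q_kA − B)` (p. 313: *"the restriction Q_kA = B on field averages"*).
[cite: BalabanImbrieJaffe1985, (4.4.2) p.312] -/
def Fibre (B : EB) : Set EA := {A | D.Qk A = B}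

/-- membership in the fibre. [cite: BalabanImbrieJaffe1985, (4.4.2) p.312] -/
theorem mem_Fibre {B : EB} {A : EA} : A ∈ D.Fibre B ↔ D.Qk A = B := Iff.rfl

variable [FiniteDimensional ℝ ES]

/-- `R` = the ORTHOGONAL PROJECTION onto `ΔN(Q′)` ([6I] p. 25, verbatim: *"The projection operator R has a clear meaning. It
is an orthogonal projection on the linear subspace ΔN(Q′_k) of L²(T_η)"*). [cite: Balaban1984PropagatorsI, p.25 (text)] -/
def projR : ES →L[ℝ] ES := D.gaugeRange.starProjection

/-- `RΔλ = Δλ` for `λ ∈ N(Q′)` ([6I] p. 25: *"Indeed RΔλ = Δλ if Q′_kλ = 0"*). [cite: Balaban1984PropagatorsI, p.25 (text)] -/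
theorem projR_lap_of_mem {l : ES} (hl : D.Qp l = 0) : D.projR (D.lap l) = D.lap l :=
  Submodule.starProjection_eq_self_iff.mpr (Submodule.mem_map_of_mem ((D.mem_kerQp).mpr hl))

/-- the Landau-gauge quadratic form `E(A) = ½‖∂A‖² + ½‖R∂*A‖²`: the exponent of `𝒢(∂*A)exp(−½‖∂A‖²)` once the λ-integral of
(4.4.1) is done (`BIJ85LandauMinimizer442.LandauOps.weight_eq`). [cite: BalabanImbrieJaffe1985, (4.4.1)–(4.4.2) p.311–312] -/
def energy (A : EA) : ℝ := (1 / 2 : ℝ) * ‖D.curl A‖ ^ 2 + (1 / 2 : ℝ) * ‖D.projR (D.dstar A)‖ ^ 2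

/-- the polar (cross) term of the quadratic form `E`: `⟨∂A, ∂v⟩ + ⟨R∂*A, R∂*v⟩`.
[cite: BalabanImbrieJaffe1985, (4.4.2) p.312] -/
def cross (A v : EA) : ℝ := ⟪D.curl A, D.curl v⟫_ℝ + ⟪D.projR (D.dstar A), D.projR (D.dstar v)⟫_ℝ

/-- `E ≥ 0`. [cite: BalabanImbrieJaffe1985, (4.4.2) p.312] -/
theorem energy_nonneg (A : EA) : 0 ≤ D.energy A := by
  unfold energy
  positivity

/-- `E(A + v) = E(A) + cross(A, v) + E(v)`. [cite: BalabanImbrieJaffe1985, (4.4.2) p.312] -/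
theorem energy_add (A v : EA) : D.energy (A + v) = D.energy A + D.cross A v + D.energy v := by
  simp only [energy, cross, map_add, norm_add_sq_real]
  ring

/-- `E(tA) = t²E(A)`. [cite: BalabanImbrieJaffe1985, (4.4.2) p.312] -/
theorem energy_smul (t : ℝ) (A : EA) : D.energy (t • A) = t ^ 2 * D.energy A := by
  simp only [energy, map_smul, norm_smul, Real.norm_eq_abs, mul_pow, sq_abs]
  ring

/-- `E(−A) = E(A)` (the Gaussian weight is even about its centre). [cite: BalabanImbrieJaffe1985, (4.4.2) p.312] -/
theorem energy_neg (A : EA) : D.energy (-A) = D.energy A := by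
  simpa using D.energy_smul (-1) A

/-- `cross(A, tv) = t·cross(A, v)`. [cite: BalabanImbrieJaffe1985, (4.4.2) p.312] -/
theorem cross_smul (A v : EA) (t : ℝ) : D.cross A (t • v) = t * D.cross A v := by
  simp only [cross, map_smul, real_inner_smul_right]
  ring

/-- `E(A + tv) = E(A) + t·cross(A, v) + t²E(v)`. [cite: BalabanImbrieJaffe1985, (4.4.2) p.312] -/
theorem energy_add_smul (A v : EA) (t : ℝ) :
    D.energy (A + t • v) = D.energy A + t * D.cross A v + t ^ 2 * D.energy v := by
  rw [energy_add, cross_smul, energy_smul]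

/-- coercivity along a fibre: `½E(v) − E(A) ≤ E(A + v)`. [cite: BalabanImbrieJaffe1985, (4.4.2) p.312] -/
theorem energy_add_ge (A v : EA) : (1 / 2 : ℝ) * D.energy v - D.energy A ≤ D.energy (A + v) := by
  have h1 := norm_sq_le_two_mul (D.curl A) (D.curl v)
  have h2 := norm_sq_le_two_mul (D.projR (D.dstar A)) (D.projR (D.dstar v))
  simp only [energy, map_add]
  linarith

/-- **first-order condition at the constrained minimizer** (p. 313 «the configuration which minimizes … subject to … the
restriction Q_kA = B»): if `A₀` minimizes `E` on the fibre `{Q_kA = B}` then `E(A₀ + v) = E(A₀) + E(v)` for every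
`v ∈ N(Q_k)` (the cross term vanishes). [cite: BalabanImbrieJaffe1985, p.313 (text)] -/
theorem energy_split_of_isMinOn {B : EB} {A₀ : EA} (hA₀ : D.Qk A₀ = B) (hmin : IsMinOn D.energy (D.Fibre B) A₀)
    {v : EA} (hv : D.Qk v = 0) : D.energy (A₀ + v) = D.energy A₀ + D.energy v := by
  have hcross : D.cross A₀ v = 0 := by
    apply eq_zero_of_quad_nonneg (D.energy_nonneg v)
    intro t
    have hmem : A₀ + t • v ∈ D.Fibre B := by
      rw [mem_Fibre, map_add, map_smul, hv, hA₀, smul_zero, add_zero]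
    have h := (isMinOn_iff.mp hmin) _ hmem
    rw [energy_add_smul] at h
    linarith
  rw [energy_add, hcross, add_zero]

variable [FiniteDimensional ℝ EA] in
/-- `E` is continuous. [cite: BalabanImbrieJaffe1985, (4.4.2) p.312] -/
theorem continuous_energy : Continuous D.energy := by
  have h1 : Continuous D.curl := D.curl.continuous_of_finiteDimensional
  have h2 : Continuous D.dstar := D.dstar.continuous_of_finiteDimensional
  have h3 : Continuous D.projR := D.projR.continuous
  unfold energy
  fun_prop

/-! ## Coercivity and existence of the constrained minimizer -/

section Minimizer

variable [FiniteDimensional ℝ EA]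

/-- **no zero modes ⇒ coercivity.**  The NO-ZERO-MODES input (hypothesis `hZ`; Landau-gauge form of the claim of p. 309, verbatim
there for the axial gauge: *"The reader may wonder whether ∂ has zero modes on the subspace of gauge fields satisfying Q_kA = 0 and
satisfying the axial gauge condition. Such zero modes do not occur, and as a consequence the integral (4.1.1) is convergent also
for noncompact gauge fields"*; = [6I] p. 30 «Δ_a is a positive operator», `⟨A, Δ_aA⟩ = ‖∂A‖² + ‖R∂*A‖² + a‖Q_kA‖²`): a bond field
with `Q_kA = 0`, `∂A = 0`, `R∂*A = 0` vanishes.  In finite dimension it gives `m‖v‖² ≤ E(v)` on `N(Q_k)` for some `m > 0`.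
[cite: BalabanImbrieJaffe1985, p.309 (text)] -/
theorem energy_lower (hZ : ∀ v : EA, D.Qk v = 0 → D.curl v = 0 → D.projR (D.dstar v) = 0 → v = 0) : ∃ m : ℝ, 0 < m ∧ ∀ v : D.kerQk, m * ‖v‖ ^ 2 ≤ D.energy (v : EA) := by
  let T : D.kerQk →ₗ[ℝ] EP × ES :=
    (D.curl.comp D.kerQk.subtype).prod (((D.projR : ES →ₗ[ℝ] ES).comp D.dstar).comp D.kerQk.subtype)
  have hT : LinearMap.ker T = ⊥ := by
    rw [LinearMap.ker_eq_bot']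
    intro v hv
    have h1 : D.curl (v : EA) = 0 := congrArg Prod.fst hv
    have h2 : D.projR (D.dstar (v : EA)) = 0 := congrArg Prod.snd hv
    have h0 : (v : EA) = 0 := hZ v ((D.mem_kerQk).mp v.2) h1 h2
    exact Subtype.ext h0
  obtain ⟨m, hm, hle⟩ := exists_mul_norm_sq_le T hT
  refine ⟨m / 2, half_pos hm, fun v => ?_⟩
  have hTv : ‖T v‖ ^ 2 ≤ ‖D.curl (v : EA)‖ ^ 2 + ‖D.projR (D.dstar (v : EA))‖ ^ 2 := by
    have hn : ‖T v‖ = max ‖D.curl (v : EA)‖ ‖D.projR (D.dstar (v : EA))‖ := rfl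
    rw [hn]
    rcases le_total ‖D.curl (v : EA)‖ ‖D.projR (D.dstar (v : EA))‖ with hle' | hle'
    · rw [max_eq_right hle']
      nlinarith [norm_nonneg (D.curl (v : EA))]
    · rw [max_eq_left hle']
      nlinarith [norm_nonneg (D.projR (D.dstar (v : EA)))]
  have := hle v
  simp only [energy]
  linarith

/-- **existence of the constrained minimizer**: with no zero modes, on every non-empty fibre `{Q_kA = B}` the form `E` attains its
minimum (coercivity + compactness in finite dimension). [cite: BalabanImbrieJaffe1985, p.313 (text)] -/
theorem exists_isMinOn (hZ : ∀ v : EA, D.Qk v = 0 → D.curl v = 0 → D.projR (D.dstar v) = 0 → v = 0)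
    {B : EB} {A₁ : EA} (hA₁ : D.Qk A₁ = B) :
    ∃ A₀ : EA, D.Qk A₀ = B ∧ IsMinOn D.energy (D.Fibre B) A₀ := by
  obtain ⟨m, hm, hle⟩ := D.energy_lower hZ
  let φ : D.kerQk → ℝ := fun v => D.energy (A₁ + (v : EA))
  have hφ : Continuous φ := D.continuous_energy.comp (continuous_const.add continuous_subtype_val)
  have hcoer : ∀ v : D.kerQk, m / 2 * ‖v‖ ^ 2 - D.energy A₁ ≤ φ v := by
    intro v
    have h1 := D.energy_add_ge A₁ (v : EA)
    have h2 := hle v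
    show m / 2 * ‖v‖ ^ 2 - D.energy A₁ ≤ D.energy (A₁ + (v : EA))
    linarith
  set S : Set D.kerQk := {v | φ v ≤ φ 0} with hS
  have hS_closed : IsClosed S := isClosed_le hφ continuous_const
  have hφ0 : φ 0 = D.energy A₁ := by simp [φ]
  have hS_bdd : Bornology.IsBounded S := by
    rw [Metric.isBounded_iff_subset_closedBall 0]
    refine ⟨Real.sqrt (4 * D.energy A₁ / m), fun v hv => ?_⟩
    rw [Metric.mem_closedBall, dist_zero_right]
    have hv' : φ v ≤ D.energy A₁ := by simpa [hS, hφ0] using hv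
    have hsq : ‖v‖ ^ 2 ≤ 4 * D.energy A₁ / m := by
      rw [le_div_iff₀ hm]
      have := hcoer v
      nlinarith
    calc ‖v‖ = Real.sqrt (‖v‖ ^ 2) := (Real.sqrt_sq (norm_nonneg _)).symm
      _ ≤ Real.sqrt (4 * D.energy A₁ / m) := Real.sqrt_le_sqrt hsq
  have hS_cpt : IsCompact S := Metric.isCompact_of_isClosed_isBounded hS_closed hS_bdd
  have h0S : (0 : D.kerQk) ∈ S := show φ 0 ≤ φ 0 from le_refl _
  have hS_ne : S.Nonempty := ⟨0, h0S⟩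
  obtain ⟨v₀, _, hv₀min⟩ := hS_cpt.exists_isMinOn hS_ne hφ.continuousOn
  refine ⟨A₁ + (v₀ : EA), by rw [map_add, hA₁, (D.mem_kerQk).mp v₀.2, add_zero], ?_⟩
  rw [isMinOn_iff]
  intro A hA
  have hw : A - A₁ ∈ D.kerQk := by
    rw [mem_kerQk, map_sub, D.mem_Fibre.mp hA, hA₁, sub_self]
  set w : D.kerQk := ⟨A - A₁, hw⟩
  have hAw : A = A₁ + (w : EA) := by simp [w]
  rw [hAw]
  change φ v₀ ≤ φ w
  by_cases hwS : w ∈ S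
  · exact (isMinOn_iff.mp hv₀min) w hwS
  · have h0 : φ v₀ ≤ φ 0 := (isMinOn_iff.mp hv₀min) 0 h0S
    have h1 : φ 0 < φ w := lt_of_not_ge hwS
    exact h0.trans h1.le

end Minimizer

/-! ## The gauge condition -/

/-- the abelian gauge structure linking the five operators: gauge transformations `A ↦ A + ∂λ` by the gradient `grad = ∂` of
site functions, with `∂(∂λ) = 0` on plaquettes, `∂*(∂λ) = Δλ`, and `Q_k(∂λ) = ∂(Q′λ)` ([6I] (1.13)/(1.20): *"QA^λ = QA − ∂Q′λ"*)
hence `Q_k∂λ = 0` for `λ ∈ N(Q′)`. [cite: Balaban1984PropagatorsI, (1.20) p.20] -/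
structure GaugeStructure (grad : ES →ₗ[ℝ] EA) : Prop where
  /-- `∂∂λ = 0` -/
  curl_grad : ∀ l : ES, D.curl (grad l) = 0
  /-- `∂*∂λ = Δλ` -/
  dstar_grad : ∀ l : ES, D.dstar (grad l) = D.lap l
  /-- `Q_k∂λ = 0` whenever `Q′λ = 0` -/
  Qk_grad : ∀ l : ES, D.Qp l = 0 → D.Qk (grad l) = 0

/-- **the constrained minimizer is in the LANDAU GAUGE of [6I]**: if `A₀` minimizes `E = ½‖∂A‖² + ½‖R∂*A‖²` on `{Q_kA = B}`,
then `R∂*A₀ = 0` ([6I] p. 26: *"under the conditions Q_kA = B, R∂*A = 0"*; p. 313: *"subject to a gauge condition"*).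
[cite: Balaban1984PropagatorsI, (1.47) p.26] -/
theorem projR_dstar_eq_zero_of_isMinOn {grad : ES →ₗ[ℝ] EA} (hg : D.GaugeStructure grad) {B : EB} {A₀ : EA}
    (hA₀ : D.Qk A₀ = B) (hmin : IsMinOn D.energy (D.Fibre B) A₀) : D.projR (D.dstar A₀) = 0 := by
  have hinner : ∀ l : ES, D.Qp l = 0 → ⟪D.projR (D.dstar A₀), D.lap l⟫_ℝ = 0 := by
    intro l hl
    have hsplit := D.energy_split_of_isMinOn hA₀ hmin (hg.Qk_grad l hl)
    rw [energy_add] at hsplit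
    have hx : D.cross A₀ (grad l) = 0 := by linarith
    rw [cross, hg.curl_grad, inner_zero_right, zero_add, hg.dstar_grad, D.projR_lap_of_mem hl] at hx
    exact hx
  have hmemO : D.projR (D.dstar A₀) ∈ D.gaugeRangeᗮ := by
    rw [Submodule.mem_orthogonal']
    intro u hu
    obtain ⟨l, hl, rfl⟩ := Submodule.mem_map.mp hu
    exact hinner l ((D.mem_kerQp).mp hl)
  have hmem : D.projR (D.dstar A₀) ∈ D.gaugeRange := Submodule.starProjection_apply_mem _ _
  exact inner_self_eq_zero.mp (Submodule.inner_right_of_mem_orthogonal hmem hmemO)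

/-- **… and it minimizes `½‖∂A‖²` on the Landau-gauge fibre `{Q_kA = B, R∂*A = 0}`** (p. 313, verbatim: *"H_kB is the
configuration which minimizes the action ½‖∂A‖², subject to a gauge condition as well as the restriction Q_kA = B on field
averages"*; [6I] p. 26: *"a configuration A on T_η minimizing the form ½⟨∂A, ∂A⟩ under the conditions Q_kA = B, R∂*A = 0"*).
[cite: BalabanImbrieJaffe1985, p.313 (text)] -/
theorem isMinOn_curl_of_isMinOn {grad : ES →ₗ[ℝ] EA} (hg : D.GaugeStructure grad) {B : EB} {A₀ : EA}
    (hA₀ : D.Qk A₀ = B) (hmin : IsMinOn D.energy (D.Fibre B) A₀) :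
    IsMinOn (fun A => (1 / 2 : ℝ) * ‖D.curl A‖ ^ 2) {A | D.Qk A = B ∧ D.projR (D.dstar A) = 0} A₀ := by
  rw [isMinOn_iff]
  rintro A ⟨hA, hAP⟩
  have h0 := D.projR_dstar_eq_zero_of_isMinOn hg hA₀ hmin
  have h := (isMinOn_iff.mp hmin) A hA
  simp only [energy, h0, hAP, norm_zero] at h
  simpa using h

end LandauOps

end

end Literature.MathematicalPhysics.QuantumFieldTheory.BalabanImbrieJaffe1984to88.BIJ85LandauForm441
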